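import Summits.BirchSwinnertonDyer.BirchSwinnertonDyer.Theses.KatoTransfer
import Summits.BirchSwinnertonDyer.BirchSwinnertonDyer.Theses.TangentCone
import Literature.NumberTheory.EllipticCurves.SupersingularDensityProofs
import Literature.NumberTheory.EllipticCurves.IwasawaLeadingTermProofs
import Literature.NumberTheory.EllipticCurves.BSDSha

/-!
# Disproof of `ShaCorankZeroAtOnePrime` (stmt-BirchSwinnertonDyer-18411) — findings of the birth crux-attack (cycle 1): NO KILL

Crux (verbatim, `Theses/KatoTransfer.lean`, item X1 of route-BirchSwinnertonDyer-KatoTransfer):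
`∀ (W : WeierstrassCurve ℚ) [W.IsElliptic] [W.IsGloballyMinimal], ∃ (p : ℕ) (_ : Fact p.Prime), 5 ≤ p ∧
  W.HasGoodReductionAtPrime p ∧ ¬ (p : ℤ) ∣ W.frobeniusTrace p ∧ W.shaCorank p = 0`.
Refuter seat refuter-rattack-stmt-BirchSwinnertonDyer-18411-0, 2026-08-17. Evidence lemmas only (reading /
domination / counterexample shape); nothing here is a Theorems landing, and no `¬ X1` exists: a
counterexample would be a curve refuting the Tate–Shafarevich conjecture at every good ordinary p ≥ 5.
Later disprover seats: EXTEND this file (sections §6+), do not restart it.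

## Findings (index)

* §1 READING. The decl unfolds verbatim; `shaCorank p = zpCorank Ш[p^∞] p =
  dim_𝔽ₚ Ш[p^∞][p] − dim_𝔽ₚ Ш[p^∞]/p` (ℕ-subtraction, `finrank` junk 0 in infinite dimension) is the
  honest corank because `Ш[p]` is finite (tree theorem `finite_sha_torsionBy_holds`): the tree proves
  `Finite Ш[p^∞] ↔ shaCorank p = 0` (`finite_primaryComponent_sha_iff_shaCorank_eq_zero`). Hence
  X1 ⟺ "every E/ℚ (global minimal model) has a good ordinary p ≥ 5 with Ш(E/ℚ)[p^∞] finite" (`x1_iff`).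
* §2 NON-VACUITY of the ∃: the admissible-prime clause `∃ p ≥ 5 prime, good, p ∤ a_p` is, in exactly
  this shape, the tree THEOREM `exists_good_ordinary_prime_of_infinite infinite_goodOrdinaryPrimes_holds`
  (std axioms) — so X1 is never false "for lack of an ordinary prime" (CM curves included).
* §3 DOMINATION. X1 is implied by the existing crux `TangentCone.SelmerRankShaPFinite`
  (stmt-BirchSwinnertonDyer-0132, ∀E ∀p finiteness of Ш[p^∞]) and by `ShaFiniteConjecture` (bsd.S02):
  `x1_of_selmerRankShaPFinite`, `x1_of_shaFiniteConjecture`. A counterexample to X1 is a curve with an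
  infinitely p-divisible Ш-class at EVERY good ordinary p ≥ 5 — it would refute SHAFIN; none is known.
* §4 COUNTEREXAMPLE SHAPE. `¬ X1 ↔ ∃ W, ∀ admissible p, rank E(ℚ) < corank Sel_{p^∞}` (`not_x1_iff`),
  via the PROVED Kummer identity `s_p = r + shaCorank p`.
* §5 NOT A RESTATEMENT OF THE SUMMIT: `BirchSwinnertonDyer` (= r_an = r_MW) neither visibly implies X1
  (p-parity only makes `shaCorank p` even) nor follows from it; no `exact?`/`aesop` closes either direction
  (Scratch.lean in the seat folder: simp / aesop / exact? on X1, `exact?` on S → C and on C → S: 5 failures).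
* LOAD-BEARING (on paper, not formalised): `[W.IsElliptic]` is needed only through the good-reduction
  clause (a singular globally-integral cubic has no prime of good reduction, so the ∃ fails there);
  `[W.IsGloballyMinimal]` cannot be dropped (argument of `frobeniusTrace`). The clauses `5 ≤ p`, good,
  ordinary are conclusions, and dropping any of them gives a consequence of X1 ("∃ p, Ш[p^∞] finite" is
  itself open for r_an ≥ 2). Natural strengthenings (∀ admissible p; `Ш[p^∞] = 0` at one admissible p;
  an effective bound p ≤ B(N_E)) are all consequences of SHAFIN (+ Ш[p] = 0 for p ≫ 0) — none refutable.
-/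

set_option linter.dupNamespace false

noncomputable section

open scoped Classical

namespace Summit.BirchSwinnertonDyer.BirchSwinnertonDyer.Cruxes.ShaCorankZeroAtOnePrime.Disproof

open Summit.BirchSwinnertonDyer.BirchSwinnertonDyer.Theses.KatoTransfer
open Summit.BirchSwinnertonDyer.BirchSwinnertonDyer.Theses.TangentCone (SelmerRankShaPFinite)
open Literature.NumberTheory.EllipticCurves
open WeierstrassCurve

/-! ## §1 Reading -/

/-- X1 is, clause for clause, "∃ good ordinary `p ≥ 5` with `Ш(E/ℚ)[p^∞]` finite". [folklore] -/
theorem x1_iff :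
    ShaCorankZeroAtOnePrime ↔ ∀ (W : WeierstrassCurve ℚ) [W.IsElliptic] [W.IsGloballyMinimal],
      ∃ (p : ℕ) (_ : Fact p.Prime), 5 ≤ p ∧ W.HasGoodReductionAtPrime p ∧
        ¬ (p : ℤ) ∣ W.frobeniusTrace p ∧ Finite (AddCommGroup.primaryComponent W.sha p) := by
  constructor
  · intro h W _ _
    obtain ⟨p, hp, h5, hgood, hord, hsha⟩ := h W
    exact ⟨p, hp, h5, hgood, hord, (finite_primaryComponent_sha_iff_shaCorank_eq_zero W p).2 hsha⟩
  · intro h W _ _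
    obtain ⟨p, hp, h5, hgood, hord, hsha⟩ := h W
    exact ⟨p, hp, h5, hgood, hord, (finite_primaryComponent_sha_iff_shaCorank_eq_zero W p).1 hsha⟩

/-! ## §2 Non-vacuity of the prime supply -/

/-- The admissible-prime clause of X1 alone is a tree theorem (Serre 1981 §8 / elementary
discharge `infinite_goodOrdinaryPrimes_holds`). [folklore] -/
theorem admissible_prime_exists (W : WeierstrassCurve ℚ) [W.IsElliptic] [W.IsGloballyMinimal] :
    ∃ (p : ℕ) (_ : Fact p.Prime), 5 ≤ p ∧ W.HasGoodReductionAtPrime p ∧ ¬ (p : ℤ) ∣ W.frobeniusTrace p :=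
  exists_good_ordinary_prime_of_infinite infinite_goodOrdinaryPrimes_holds W

/-! ## §3 Domination by existing statements -/

/-- Prime-by-prime finiteness of `Ш[p^∞]` for all elliptic `W/ℚ` at all `p` (hypothesis) gives X1. [folklore] -/
theorem x1_of_forall_finite
    (h : ∀ (W : WeierstrassCurve ℚ) [W.IsElliptic] [W.IsGloballyMinimal] (p : ℕ) [Fact p.Prime],
      Finite (AddCommGroup.primaryComponent W.sha p)) : ShaCorankZeroAtOnePrime := by
  intro W _ _
  obtain ⟨p, hp, h5, hgood, hord⟩ := admissible_prime_exists W
  exact ⟨p, hp, h5, hgood, hord, (finite_primaryComponent_sha_iff_shaCorank_eq_zero W p).1 (h W p)⟩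

/-- X1 is WEAKER than the existing crux `TangentCone.SelmerRankShaPFinite` (stmt-BirchSwinnertonDyer-0132). [folklore] -/
theorem x1_of_selmerRankShaPFinite (h : SelmerRankShaPFinite) : ShaCorankZeroAtOnePrime :=
  x1_of_forall_finite fun W _ _ p _ => h W p

/-- X1 is WEAKER than the Tate–Shafarevich conjecture over `ℚ` (bsd.S02, `ShaFiniteConjecture`). [folklore] -/
theorem x1_of_shaFiniteConjecture (h : ShaFiniteConjecture) : ShaCorankZeroAtOnePrime := by
  refine x1_of_forall_finite fun W hW _ p _ => ?_
  haveI : Finite W.sha := h W hW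
  infer_instance

/-! ## §4 Counterexample shape -/

/-- X1 ⟺ every curve has an admissible prime at which `corank Sel_{p^∞} = rank E(ℚ)`
(Kummer identity `selmerCorank_eq_mordellWeilRank_add_holds`, proved in the tree). [folklore] -/
theorem x1_iff_selmerCorank_eq_rank :
    ShaCorankZeroAtOnePrime ↔ ∀ (W : WeierstrassCurve ℚ) [W.IsElliptic] [W.IsGloballyMinimal],
      ∃ (p : ℕ) (_ : Fact p.Prime), 5 ≤ p ∧ W.HasGoodReductionAtPrime p ∧
        ¬ (p : ℤ) ∣ W.frobeniusTrace p ∧ W.selmerCorank p = W.mordellWeilRank := by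
  constructor
  · intro h W _ _
    obtain ⟨p, hp, h5, hgood, hord, hsha⟩ := h W
    refine ⟨p, hp, h5, hgood, hord, ?_⟩
    have := W.selmerCorank_eq_mordellWeilRank_add_holds p
    omega
  · intro h W _ _
    obtain ⟨p, hp, h5, hgood, hord, hs⟩ := h W
    refine ⟨p, hp, h5, hgood, hord, ?_⟩
    have := W.selmerCorank_eq_mordellWeilRank_add_holds p
    omega

/-- The shape of a counterexample: ONE curve with `rank E(ℚ) < corank Sel_{p^∞}(E/ℚ)` at EVERY good
ordinary `p ≥ 5` (an infinitely `p`-divisible Ш-class at every such `p`). [folklore] -/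
theorem not_x1_iff :
    ¬ ShaCorankZeroAtOnePrime ↔ ∃ (W : WeierstrassCurve ℚ) (_ : W.IsElliptic) (_ : W.IsGloballyMinimal),
      ∀ (p : ℕ) [Fact p.Prime], 5 ≤ p → W.HasGoodReductionAtPrime p →
        ¬ (p : ℤ) ∣ W.frobeniusTrace p → W.mordellWeilRank < W.selmerCorank p := by
  rw [x1_iff_selmerCorank_eq_rank]
  constructor
  · intro h
    by_contra hne
    apply h
    intro W _ _
    by_contra hW
    apply hne
    refine ⟨W, ‹_›, ‹_›, fun p _ h5 hgood hord => ?_⟩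
    have hk := W.selmerCorank_eq_mordellWeilRank_add_holds p
    have hneq : W.selmerCorank p ≠ W.mordellWeilRank := fun heq => hW ⟨p, ‹_›, h5, hgood, hord, heq⟩
    omega
  · rintro ⟨W, hW, hM, hall⟩ h
    obtain ⟨p, hp, h5, hgood, hord, heq⟩ := @h W hW hM
    have := @hall p hp h5 hgood hord
    omega

/-! ## §5 Rank ≤ 1 instances are theorems in print (not re-proved here)

For `r_an ≤ 1`, Kolyvagin + Gross–Zagier give `Ш(E/ℚ)` finite, hence X1 at every admissible `p`;
the open content of X1 is exactly the `r_an ≥ 2` locus, where each instance is certified case by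
case by `p`-descent / Stein–Wuthrich Alg. 11.1 (`Ш[p] = 0 ⇒ Ш[p^∞] = 0`). -/

end Summit.BirchSwinnertonDyer.BirchSwinnertonDyer.Cruxes.ShaCorankZeroAtOnePrime.Disproof

#print axioms Summit.BirchSwinnertonDyer.BirchSwinnertonDyer.Cruxes.ShaCorankZeroAtOnePrime.Disproof.x1_iff
#print axioms Summit.BirchSwinnertonDyer.BirchSwinnertonDyer.Cruxes.ShaCorankZeroAtOnePrime.Disproof.x1_of_selmerRankShaPFinite
#print axioms Summit.BirchSwinnertonDyer.BirchSwinnertonDyer.Cruxes.ShaCorankZeroAtOnePrime.Disproof.not_x1_iff
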